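import Literature.NumberTheory.LFunctions.ConreyIwaniec2002
import Mathlib.Analysis.SpecialFunctions.Trigonometric.Sinc
import HarnessLib

/-!
# Conrey–Iwaniec (2002), §9: the principal estimate (Proposition 9.2) — the FACT-LIST boundary of
# the Conrey–Iwaniec corpus, from which §10 (Proposition 10.1, Theorem 1.1, Corollaries 1.3, 10.2)
# is elementary

LABEL: **NOT RH-BEARING.** Proposition 9.2 is an UNCONDITIONAL mean-value inequality for the
class group `L`-functions of `ℚ(√−q)` ("it has some quality only in the absence of the Riemann
hypothesis", §9): no statement here assumes or concludes anything about `RiemannHypothesis`;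
nothing here bears on the truth of RH (cell `rh-crit`, corpus C5 `ah`, node CI02:Prop9.2, marked
BOUNDARY: it rests on §§2–8 — automorphic forms, summation formulas, convolution sums, the
approximate functional equation — which this corpus does not type).

Topic `Literature/NumberTheory/LFunctions` (namespace `Literature.NumberTheory.LFunctions`, paper
objects under `ConreyIwaniec2002`). STATEMENT LAYER, first instalment of the optional "mean values"
module of the C5 assignment (§4 Theorem 4.1/Corollary 4.2/Theorems 4.3–4.4, §5, §6 Theorem 6.1 …,
§9 Proposition 9.1 are second-wave and NOT typed here): ONE NAMED FACT (D-0014),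
`conreyIwaniec2002_proposition92`, plus proved API for the summand `|sin((t−t′)log t)/((t−t′)log t)|`
(Mathlib's `Real.sinc`), including Corollary 7.6's elementary inequality
"`sin x ≥ αx` if `0 ≤ x ≤ π(1−α)`" in the form used at (10.8).

## What the source prints (held text `paper:arxiv-math_0111012`, chunk p0020:L60–120, p0021:L1–50)

Standing data of §7 (p0017:L17–35): `K = ℚ(√−q)`, `−q` the discriminant, **`q` odd**, `q > 4`
(so `q ≡ 3 (mod 4)`, squarefree), `ψ ∈ Ĉℓ(K)`, `L(s) = L(s,ψ)` (7.3), `χ = (·/q)` (7.2),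
`L(s) = ζ(s)L(s,χ)` for `ψ` trivial (7.7). §9 (p0020:L45–53): "`ℓ(s) = (L(s) − L(s′))(s − s′)^{−1}`
… `Δ(T) = Σ_s |ℓ(s)|² = Σ_s |(L(s) − L(s′))/(s − s′)|²` (9.8)". "Finally, we no longer restrict the
points `s = ½ + it` to a dyadic segment `T < t ≤ 2T`. … We state the result in a self-contained
format."

> **Proposition 9.2** (p0020:L86–98). Let `s` run over a set of points on the critical line
> `s = ½ + it` with `2 ≤ t ≤ T` which are spaced by at least one. To every `s` in the set we
> associate a point `s′ = ½ + it′`. Then we have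
> `Σ_s |sin((t−t′) log t) / ((t−t′) log t)| ≪ (T/log T)(log q)^6 + T (log T) L(1,χ)^{1/2} (log q)^3`
> `  + ((log q)^{5/2}/log T) · (T Σ_s |(L(s) − L(s′))/(s − s′)|²)^{1/2}` (9.12).

"This is our principal estimate from which one can deduce numerous attractive propositions."
(p0020:L100.) The implied constant is absolute (Proposition 9.1 (9.7): "the implied constant is
absolute"; §10 (10.9): "where the implied constant is absolute"). §10 then derives Proposition 10.1
from (9.12) by (10.2)–(10.9) — in particular (10.8): for `|t − t′| ≤ π(1−α)/log t`,
`sin((t−t′)log t)/((t−t′)log t) ≥ α`, "applying the inequality `sin x ≥ αx` if `0 ≤ x ≤ π(1−α)`"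
(Corollary 7.6, p0018:L100–109).

## Lean rendering / design choices (audit notes for rh-crit-ah-ref)

* Same dictionary as `ConreyIwaniec2002.lean`: `χ : DirichletCharacter ℂ q` primitive quadratic
  odd, `4 < q`, `Odd q` (§7) EXPLICIT; `K : Type` with `finrank ℚ K = 2`, `discr K = −q`;
  `ψ : ClassGroup (𝓞 K) →* ℂˣ`, `L(s) = classGroupLFunction K ψ`; the point set is a
  `ConreyIwaniec2002.IsPointSet S T` (finite, in `[2,T]`, pairwise `1`-separated); companions
  `t′ : ℝ → ℝ`, unrestricted as printed ("to every `s` … we associate a point `s′ = ½ + it′`");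
  `(L(s) − L(s′))/(s − s′)` is `ConreyIwaniec2002.dividedDifference` (value `L′(s)` at `s′ = s`, the
  §10 convention (10.1)); `L(1,χ)^{1/2} = √‖L(1,χ)‖`, `(…)^{1/2} = √(…)` (`Real.sqrt`);
  `(log q)^{5/2}` is `Real.rpow`.
* The summand `sin((t−t′)log t)/((t−t′)log t)` at `t′ = t` is its limit `1` — Mathlib's
  `Real.sinc`, so the left side is `Σ_{t ∈ S} |Real.sinc ((t − t′ t) log t)|`.
* "`≪`" with an absolute constant: `∃ C > 0` outermost. Guard `2 ≤ T` (printed: `2 ≤ t ≤ T`; it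
  keeps `log T > 0` on the right-hand side when `S = ∅`).

WHAT THIS IS NOT: a claim about RH, about Siegel zeros, or about the size of `L(1,χ)`. Discharge
target served: `conreyIwaniec2002_proposition101` from `conreyIwaniec2002_proposition92`
(§10 (10.2)–(10.9), elementary; prover phase, `ConreyIwaniec2002Proofs.lean`).

## References

* [ConreyIwaniec2002] B. Conrey, H. Iwaniec, Acta Arith. 103 (2002) 259–312, arXiv:math/0111012:
  §7 (7.2)/(7.3)/(7.7), Corollary 7.6 (7.29), §9 (9.8), Proposition 9.2 (9.12), §10 (10.8).
-/

noncomputable section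

open scoped NumberField
open Complex

namespace Literature.NumberTheory.LFunctions

namespace ConreyIwaniec2002

/-! ### The summand of (9.12) -/

/-- **`|sin((t − t′) log t)/((t − t′) log t)|`**, the summand of the principal estimate (9.12)
(`= |x(s)|/(2 log t)` up to `O(1/(t log t))`, (7.28)/(9.10)), with its limit value `1` at `t′ = t`
(Mathlib `Real.sinc`). [cite: ConreyIwaniec2002, Proposition 9.2 (9.12)] -/
def sincTerm (t t' : ℝ) : ℝ :=
  |Real.sinc ((t - t') * Real.log t)|

/-- `0 ≤ |sinc|`. [cite: ConreyIwaniec2002, Proposition 9.2 (9.12)] -/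
theorem sincTerm_nonneg (t t' : ℝ) : 0 ≤ sincTerm t t' :=
  abs_nonneg _

/-- `|sinc| ≤ 1`: the left side of (9.12) is at most the number of points ("the left side of
(9.12) is trivially bounded by `R ≤ T`", §9). [cite: ConreyIwaniec2002, §9 (after (9.13))] -/
theorem sincTerm_le_one (t t' : ℝ) : sincTerm t t' ≤ 1 :=
  Real.abs_sinc_le_one _

/-- At coincident companions the summand is `1`. [cite: ConreyIwaniec2002, Proposition 9.2 (9.12)] -/
@[simp] theorem sincTerm_self (t : ℝ) : sincTerm t t = 1 := by
  simp [sincTerm]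

/-- The left side of (9.12) is at most `#S`. [cite: ConreyIwaniec2002, §9 (after (9.13))] -/
theorem sum_sincTerm_le_card (S : Finset ℝ) (t' : ℝ → ℝ) :
    ∑ t ∈ S, sincTerm t (t' t) ≤ S.card := by
  calc ∑ t ∈ S, sincTerm t (t' t) ≤ ∑ t ∈ S, (1 : ℝ) :=
        Finset.sum_le_sum fun t _ => sincTerm_le_one t (t' t)
    _ = S.card := by simp

/-- **`sin x ≥ x(π − x)/π` on `[0, π]`** (from `sin x > x − x³/6`, Mathlib `Real.sin_gt_sub_cube`,
on `[0, π/2]`, and the symmetry `x ↦ π − x`). The form behind Corollary 7.6's "`sin x ≥ αx` if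
`0 ≤ x ≤ π(1−α)`". [cite: ConreyIwaniec2002, Corollary 7.6] -/
theorem mul_sub_div_pi_le_sin {x : ℝ} (h0 : 0 ≤ x) (hπ : x ≤ Real.pi) :
    x * (Real.pi - x) / Real.pi ≤ Real.sin x := by
  have hpi := Real.pi_pos
  have hpi3 := Real.pi_gt_three
  have hpi4 := Real.pi_lt_four
  -- the half `[0, π/2]`, for any `y`
  have half : ∀ y : ℝ, 0 ≤ y → y ≤ Real.pi / 2 → y * (Real.pi - y) / Real.pi ≤ Real.sin y := by
    intro y hy0 hy
    rcases hy0.eq_or_lt with rfl | hy0'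
    · simp
    have h1 := Real.sin_gt_sub_cube hy0'
    -- `y (π − y)/π = y − y²/π ≤ y − y³/6` as `y ≤ 6/π`
    have h2 : y * (Real.pi - y) / Real.pi ≤ y - y ^ 3 / 6 := by
      rw [div_le_iff₀ hpi]
      have hpi_lt := Real.pi_lt_d2
      have h3a : y * Real.pi ≤ Real.pi / 2 * Real.pi := mul_le_mul_of_nonneg_right hy hpi.le
      have h3 : y * Real.pi ≤ 6 := by nlinarith
      nlinarith [sq_nonneg y, mul_nonneg (sq_nonneg y) hy0]
    linarith
  by_cases hx : x ≤ Real.pi / 2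
  · exact half x h0 hx
  · push Not at hx
    have h := half (Real.pi - x) (by linarith) (by linarith)
    rw [Real.sin_pi_sub] at h
    calc x * (Real.pi - x) / Real.pi = (Real.pi - x) * (Real.pi - (Real.pi - x)) / Real.pi := by
          ring
      _ ≤ Real.sin x := h

/-- **Corollary 7.6 / (10.8): `sinc x ≥ α` for `|x| ≤ π(1 − α)`, `0 ≤ α ≤ 1`** ("applying the
inequality `sin x ≥ αx` if `0 ≤ x ≤ π(1−α)`"). [cite: ConreyIwaniec2002, Corollary 7.6] -/
theorem le_sinc_of_abs_le {α x : ℝ} (hα0 : 0 ≤ α) (hα1 : α ≤ 1)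
    (hx : |x| ≤ Real.pi * (1 - α)) : α ≤ Real.sinc x := by
  have hpi := Real.pi_pos
  -- reduce to `0 ≤ x` by evenness
  wlog h0 : 0 ≤ x generalizing x
  · have h := this (x := -x) (by rwa [abs_neg]) (by linarith [le_of_not_ge h0])
    rwa [Real.sinc_neg] at h
  rw [abs_of_nonneg h0] at hx
  rcases h0.eq_or_lt with rfl | hpos
  · rw [Real.sinc_zero]; exact hα1
  have hxπ : x ≤ Real.pi := by nlinarith
  rw [Real.sinc_of_ne_zero hpos.ne', le_div_iff₀ hpos]
  have h := mul_sub_div_pi_le_sin hpos.le hxπ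
  -- `α x ≤ x(π − x)/π` since `x ≤ π(1−α)`
  have h2 : α * x ≤ x * (Real.pi - x) / Real.pi := by
    rw [le_div_iff₀ hpi]
    nlinarith
  linarith

/-- (10.8) in the variables of (9.12): if `|t − t′| ≤ π(1−α)/log t` with `t > 1` and
`0 ≤ α ≤ 1`, then `|sin((t−t′)log t)/((t−t′)log t)| ≥ α`. [cite: ConreyIwaniec2002, §10 (10.8)] -/
theorem le_sincTerm_of_abs_sub_le {α t t' : ℝ} (hα0 : 0 ≤ α) (hα1 : α ≤ 1) (ht : 1 < t)
    (h : |t - t'| ≤ gapRadius α t) : α ≤ sincTerm t t' := by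
  have hlog : 0 < Real.log t := Real.log_pos ht
  refine le_trans (le_sinc_of_abs_le hα0 hα1 ?_) (le_abs_self _)
  rw [abs_mul, abs_of_pos hlog]
  unfold gapRadius at h
  rw [le_div_iff₀ hlog] at h
  linarith

end ConreyIwaniec2002

open ConreyIwaniec2002 NumberField

/-! ### The named fact -/

/-- **Conrey–Iwaniec 2002, Proposition 9.2 (the principal estimate).** "Let `s` run over a set of
points on the critical line `s = ½ + it` with `2 ≤ t ≤ T` which are spaced by at least one. To
every `s` in the set we associate a point `s′ = ½ + it′`. Then we have
`Σ_s |sin((t−t′)log t)/((t−t′)log t)| ≪ (T/log T)(log q)^6 + T(log T) L(1,χ)^{1/2}(log q)^3 + ((log q)^{5/2}/log T)(T Σ_s |(L(s) − L(s′))/(s − s′)|²)^{1/2}`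
(9.12)." Standing data of §7: `K = ℚ(√−q)`, `−q` the discriminant, **`q` odd**, `q > 4`,
`ψ ∈ Ĉℓ(K)`, `L(s) = L(s,ψ)`, `χ = (·/q)`; implied constant absolute ((9.7), (10.9)); the
quotient means `L′(s)` at `s′ = s` ((10.1), `dividedDifference`), the summand is `1` at `t′ = t`
(`Real.sinc`). Rendered with ONE absolute `C > 0` outermost, the points as a `Finset ℝ`
(`IsPointSet S T`), companions `t′ : ℝ → ℝ`, `L(1,χ)^{1/2} = √‖L(1,χ)‖`. NAMED FACT, not proved here
(it rests on §§2–9: Theorem 6.1, Proposition 6.4, the approximate functional equation §7, §8,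
Proposition 9.1). [cite: ConreyIwaniec2002, Proposition 9.2] -/
def conreyIwaniec2002_proposition92 : Prop :=
  ∃ C : ℝ, 0 < C ∧
    ∀ (q : ℕ) [NeZero q], 4 < q → Odd q → ∀ χ : DirichletCharacter ℂ q,
      χ.IsPrimitive → χ.IsQuadratic → χ.Odd →
        ∀ (K : Type) [Field K] [NumberField K],
          Module.finrank ℚ K = 2 → NumberField.discr K = -(q : ℤ) →
            ∀ (ψ : ClassGroup (𝓞 K) →* ℂˣ) (T : ℝ) (S : Finset ℝ) (t' : ℝ → ℝ),
              2 ≤ T → IsPointSet S T →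
                ∑ t ∈ S, sincTerm t (t' t) ≤
                  C * (T / Real.log T * Real.log q ^ (6 : ℕ) +
                    T * Real.log T * Real.sqrt ‖χ.LFunction 1‖ * Real.log q ^ (3 : ℕ) +
                    Real.log q ^ ((5 : ℝ) / 2) / Real.log T *
                      Real.sqrt (T * ∑ t ∈ S, ‖dividedDifference (classGroupLFunction K ψ)
                        (1 / 2 + t * I) (1 / 2 + t' t * I)‖ ^ 2))

/-! ### Bookkeeping (proved) -/

/-- The left side of (9.12) is at most `#S ≤ T − 1` for a point set in `[2, T]` ("the left side of
(9.12) is trivially bounded by `R ≤ T`", §9): a `1`-separated finite subset of `[2,T]` has at most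
`T − 1` elements. [cite: ConreyIwaniec2002, §9 (after (9.13))] -/
theorem ConreyIwaniec2002.IsPointSet.card_le {S : Finset ℝ} {T : ℝ} (h : IsPointSet S T) (hS : S.Nonempty) :
    (S.card : ℝ) ≤ T - 1 := by
  classical
  -- induction on the cardinality via the maximum: removing `max S` leaves a point set in `[2, max S − 1]`
  suffices key : ∀ n : ℕ, ∀ (S : Finset ℝ) (T : ℝ), S.card = n → S.Nonempty → IsPointSet S T →
      (S.card : ℝ) ≤ T - 1 from key _ S T rfl hS h
  intro n
  induction n with
  | zero => intro S T hc hne _; rw [Finset.card_eq_zero] at hc; exact absurd hc hne.ne_empty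
  | succ n ih =>
    intro S T hc hne hS
    obtain ⟨m, hm⟩ : ∃ m, m ∈ S ∧ ∀ t ∈ S, t ≤ m := ⟨S.max' hne, S.max'_mem hne, fun t ht => S.le_max' t ht⟩
    have hmT : m ≤ T := hS.le hm.1
    set S' := S.erase m with hS'
    have hc' : S'.card = n := by rw [hS', Finset.card_erase_of_mem hm.1, hc]; rfl
    rcases S'.eq_empty_or_nonempty with h0 | hne'
    · -- `S = {m}`
      have h1 : S.card = 1 := by
        rw [← Finset.card_erase_add_one hm.1, ← hS', h0, Finset.card_empty]
      rw [h1, Nat.cast_one]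
      linarith [hS.two_le hm.1]
    · -- the remaining points lie in `[2, m − 1]`
      have hS'pt : IsPointSet S' (m - 1) := by
        refine ⟨fun t ht => ⟨hS.two_le (Finset.mem_of_mem_erase ht), ?_⟩,
          fun t ht u hu htu => hS.2 t (Finset.mem_of_mem_erase ht) u (Finset.mem_of_mem_erase hu) htu⟩
        have htm : t ≠ m := Finset.ne_of_mem_erase ht
        have hle : t ≤ m := hm.2 t (Finset.mem_of_mem_erase ht)
        have hsep := hS.2 t (Finset.mem_of_mem_erase ht) m hm.1 htm
        rw [abs_sub_comm, abs_of_nonneg (by linarith)] at hsep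
        linarith
      have := ih S' (m - 1) hc' hne' hS'pt
      have hcard : (S.card : ℝ) = S'.card + 1 := by
        rw [hS', ← Finset.card_erase_add_one hm.1]; push_cast; ring
      rw [hcard]
      linarith


/-- A point set in `[2, T]`, `T ≥ 2`, has at most `T` elements. [cite: ConreyIwaniec2002, §9 (after (9.13))] -/
theorem ConreyIwaniec2002.IsPointSet.card_le' {S : Finset ℝ} {T : ℝ} (h : IsPointSet S T) (hT : 2 ≤ T) :
    (S.card : ℝ) ≤ T := by
  rcases S.eq_empty_or_nonempty with rfl | hS
  · simp; linarith
  · linarith [h.card_le hS]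

/-- **Proposition 10.1 follows from Proposition 9.2** — §10, (10.2)–(10.9): under (10.11) the last
term of (9.12) is absorbed by the first ((10.2)–(10.3)); if (10.13) failed, i.e.
`log T < L(1,χ)^{−1/2}(log q)^{−A−3}`, then with `log T ≥ (log q)^{A+6}` every term of (9.12) is
`≤ T(log q)^{−A}` ((10.4)–(10.5)); by (10.8) each summand is `≥ α` under (10.10), so
`αR ≤ 3C·T(log q)^{−A}` ((10.9)), contradicting (10.12) with `c = 4C` (`C` the absolute constant
of (9.12)). The side condition (10.6) of the printed argument only guarantees that the
`T`-interval (10.4) is non-void and is not needed in this contrapositive form.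
[cite: ConreyIwaniec2002, Proposition 10.1 (proof, §10 (10.2)–(10.9))] -/
theorem conreyIwaniec2002_proposition101_of_proposition92 (h : conreyIwaniec2002_proposition92) :
    conreyIwaniec2002_proposition101 := by
  classical
  obtain ⟨C, hC, hP⟩ := h
  refine ⟨4 * C, by positivity, fun A hA q _ hq hoddq χ hprim hquad hodd K _ _ h2 hdisc ψ T α S t'
    hT2 hα0 hα1 hlogTq hS h10 h11 h12 => ?_⟩
  have hq5 : (5 : ℝ) ≤ q := by exact_mod_cast hq
  have hℓ1 : 1 < Real.log q := by
    rw [Real.lt_log_iff_exp_lt (by linarith)]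
    exact Real.exp_one_lt_d9.trans_le (by linarith)
  set ℓ : ℝ := Real.log q with hℓdef
  have hℓ0 : 0 < ℓ := by linarith
  have hT0 : 0 < T := by linarith
  set Lt : ℝ := Real.log T with hLtdef
  -- `log T ≥ ℓ^{A+6} = ℓ^A ℓ^6 ≥ ℓ^A > 0`
  have hℓA : 0 < ℓ ^ A := Real.rpow_pos_of_pos hℓ0 A
  have hℓ6 : (1 : ℝ) ≤ ℓ ^ (6 : ℕ) := one_le_pow₀ hℓ1.le
  have hsplit : ℓ ^ (A + 6) = ℓ ^ A * ℓ ^ (6 : ℕ) := by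
    rw [Real.rpow_add hℓ0, show (6 : ℝ) = ((6 : ℕ) : ℝ) by norm_num, Real.rpow_natCast]
  have hLtA : ℓ ^ A * ℓ ^ (6 : ℕ) ≤ Lt := hsplit ▸ hlogTq
  have hLt0 : 0 < Lt := lt_of_lt_of_le (by positivity) hLtA
  have hℓnegA : ℓ ^ (-A) = (ℓ ^ A)⁻¹ := Real.rpow_neg hℓ0.le A
  -- the principal estimate
  have h92 := hP q hq hoddq χ hprim hquad hodd K h2 hdisc ψ T S t' hT2 hS
  -- lower bound (10.8): each summand is `≥ α`, and `α · #S ≥ 4C · T ℓ^{-A}` by (10.12)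
  have hlow : 4 * C * T * ℓ ^ (-A) ≤ ∑ t ∈ S, sincTerm t (t' t) := by
    have h1 : ∑ t ∈ S, α ≤ ∑ t ∈ S, sincTerm t (t' t) :=
      Finset.sum_le_sum fun t ht =>
        le_sincTerm_of_abs_sub_le hα0.le hα1 (by linarith [hS.two_le ht]) (h10 t ht)
    rw [Finset.sum_const, nsmul_eq_mul] at h1
    have h3 : 4 * C * T * ℓ ^ (-A) ≤ S.card * α := by
      rw [div_le_iff₀ (mul_pos hα0 hℓA)] at h12
      rw [hℓnegA, show 4 * C * T * (ℓ ^ A)⁻¹ = 4 * C * T / ℓ ^ A by rw [div_eq_mul_inv],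
        div_le_iff₀ hℓA]
      linarith
    linarith
  -- upper bound: if (10.13) failed, each term of (9.12) would be `≤ T ℓ^{-A}`
  by_contra hcon
  push Not at hcon
  -- `√‖L(1,χ)‖ < Lt⁻¹ ℓ^{-(A+3)}`
  set v : ℝ := Lt⁻¹ * ℓ ^ (-(A + 3)) with hvdef
  have hv0 : 0 < v := by positivity
  have hv2 : v ^ 2 = Lt ^ (-(2 : ℝ)) * ℓ ^ (-(2 * A + 6)) := by
    have h1 : (Lt⁻¹) ^ 2 = Lt ^ (-(2 : ℝ)) := by
      rw [Real.rpow_neg hLt0.le, Real.rpow_two, inv_pow]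
    have h2 : (ℓ ^ (-(A + 3))) ^ 2 = ℓ ^ (-(2 * A + 6)) := by
      rw [← Real.rpow_natCast (ℓ ^ (-(A + 3))) 2, ← Real.rpow_mul hℓ0.le]
      congr 1
      push_cast
      ring
    rw [hvdef, mul_pow, h1, h2]
  have hsqrt : Real.sqrt ‖χ.LFunction 1‖ < v := by
    rw [← Real.sqrt_sq hv0.le, hv2]
    exact Real.sqrt_lt_sqrt (norm_nonneg _) hcon
  -- term (i): `T ℓ^6 / Lt ≤ T ℓ^{-A}`
  have hterm1 : T / Lt * ℓ ^ (6 : ℕ) ≤ T * ℓ ^ (-A) := by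
    rw [hℓnegA, div_mul_eq_mul_div, div_le_iff₀ hLt0]
    calc T * ℓ ^ (6 : ℕ) = T * (ℓ ^ A)⁻¹ * (ℓ ^ A * ℓ ^ (6 : ℕ)) := by field_simp
      _ ≤ T * (ℓ ^ A)⁻¹ * Lt := mul_le_mul_of_nonneg_left hLtA (by positivity)
  -- term (ii): `T Lt √L(1,χ) ℓ³ ≤ T ℓ^{-A}`
  have hterm2 : T * Lt * Real.sqrt ‖χ.LFunction 1‖ * ℓ ^ (3 : ℕ) ≤ T * ℓ ^ (-A) := by
    have h1 : T * Lt * Real.sqrt ‖χ.LFunction 1‖ * ℓ ^ (3 : ℕ) ≤ T * Lt * v * ℓ ^ (3 : ℕ) := by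
      gcongr
    have h2 : T * Lt * v * ℓ ^ (3 : ℕ) = T * ℓ ^ (-A) := by
      have h3 : ℓ ^ (-(A + 3)) * ℓ ^ (3 : ℕ) = ℓ ^ (-A) := by
        rw [← Real.rpow_natCast ℓ 3, ← Real.rpow_add hℓ0]
        congr 1
        push_cast
        ring
      calc T * Lt * v * ℓ ^ (3 : ℕ) = T * (Lt * Lt⁻¹) * (ℓ ^ (-(A + 3)) * ℓ ^ (3 : ℕ)) := by
            rw [hvdef]; ring
        _ = T * ℓ ^ (-A) := by rw [mul_inv_cancel₀ hLt0.ne', h3, mul_one]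
    linarith
  -- term (iii): `ℓ^{5/2}/Lt · √(T Σ |ℓ(s)|²) ≤ T ℓ^6/Lt ≤ T ℓ^{-A}`
  have hcardT : (S.card : ℝ) ≤ T := hS.card_le' hT2
  have hsum : ∑ t ∈ S, ‖dividedDifference (classGroupLFunction K ψ) (1 / 2 + t * I)
      (1 / 2 + t' t * I)‖ ^ 2 ≤ T * ℓ ^ (7 : ℕ) := by
    have h72 : (ℓ ^ ((7 : ℝ) / 2)) ^ 2 = ℓ ^ (7 : ℕ) := by
      rw [← Real.rpow_natCast (ℓ ^ ((7 : ℝ) / 2)) 2, ← Real.rpow_mul hℓ0.le]; norm_num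
    calc ∑ t ∈ S, ‖dividedDifference (classGroupLFunction K ψ) (1 / 2 + t * I)
          (1 / 2 + t' t * I)‖ ^ 2 ≤ ∑ t ∈ S, (ℓ ^ ((7 : ℝ) / 2)) ^ 2 :=
          Finset.sum_le_sum fun t ht => pow_le_pow_left₀ (norm_nonneg _) (h11 t ht) 2
      _ = S.card * ℓ ^ (7 : ℕ) := by rw [Finset.sum_const, nsmul_eq_mul, h72]
      _ ≤ T * ℓ ^ (7 : ℕ) := by gcongr
  have hterm3 : ℓ ^ ((5 : ℝ) / 2) / Lt * Real.sqrt (T * ∑ t ∈ S, ‖dividedDifference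
      (classGroupLFunction K ψ) (1 / 2 + t * I) (1 / 2 + t' t * I)‖ ^ 2) ≤ T * ℓ ^ (-A) := by
    have h1 : Real.sqrt (T * ∑ t ∈ S, ‖dividedDifference (classGroupLFunction K ψ)
        (1 / 2 + t * I) (1 / 2 + t' t * I)‖ ^ 2) ≤ T * ℓ ^ ((7 : ℝ) / 2) := by
      rw [← Real.sqrt_sq (show (0 : ℝ) ≤ T * ℓ ^ ((7 : ℝ) / 2) by positivity)]
      refine Real.sqrt_le_sqrt ?_
      have h72 : (ℓ ^ ((7 : ℝ) / 2)) ^ 2 = ℓ ^ (7 : ℕ) := by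
        rw [← Real.rpow_natCast (ℓ ^ ((7 : ℝ) / 2)) 2, ← Real.rpow_mul hℓ0.le]; norm_num
      rw [mul_pow, h72]
      nlinarith [hsum, hT0]
    have h56 : ℓ ^ ((5 : ℝ) / 2) * ℓ ^ ((7 : ℝ) / 2) = ℓ ^ (6 : ℕ) := by
      rw [← Real.rpow_add hℓ0]; norm_num
    calc ℓ ^ ((5 : ℝ) / 2) / Lt * Real.sqrt (T * ∑ t ∈ S, ‖dividedDifference
          (classGroupLFunction K ψ) (1 / 2 + t * I) (1 / 2 + t' t * I)‖ ^ 2)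
        ≤ ℓ ^ ((5 : ℝ) / 2) / Lt * (T * ℓ ^ ((7 : ℝ) / 2)) :=
          mul_le_mul_of_nonneg_left h1 (by positivity)
      _ = T / Lt * ℓ ^ (6 : ℕ) := by rw [← h56]; field_simp
      _ ≤ T * ℓ ^ (-A) := hterm1
  -- assemble: `4C T ℓ^{-A} ≤ Σ ≤ C · 3 T ℓ^{-A}`
  have hup : ∑ t ∈ S, sincTerm t (t' t) ≤ C * (3 * (T * ℓ ^ (-A))) := by
    refine h92.trans (mul_le_mul_of_nonneg_left ?_ hC.le)
    linarith
  have hpos : 0 < C * (T * ℓ ^ (-A)) := by positivity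
  linarith

end Literature.NumberTheory.LFunctions

end
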